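import Summits.BirchSwinnertonDyer.BirchSwinnertonDyer.Theorems.ClassRecordThreeCornerAtThreeUpperConverse
import Summits.BirchSwinnertonDyer.BirchSwinnertonDyer.Theorems.ClassRecordThreeCornerAtThreeBranches
import Summits.BirchSwinnertonDyer.BirchSwinnertonDyer.Theorems.ErratumRoadFiveNonSurjCornerLower
import HarnessLib

/-!
# Crux `CornerAtThreeW` (item stmt-BirchSwinnertonDyer-21420; routes `ClassRecordThree` ∕ `KolyvaginRoadThree`, rung K2@3) —
# THE (Tw)-SIDE BENEFIT CUT, file 1/2: conjunct (U) at EVERY frame needs only the twin's KATO half — the SHARPENED converse bridge (A′)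
# (cell `bsd-stepL`, seat `bsd-stepL-corner3-p2` g16 = WIDTH-LEVER lane B; `--supports stmt-BirchSwinnertonDyer-21420 --as helper`)

HONEST FRAMING: THEOREMS ONLY (no definition, no named fact, no `sorry`); every theorem is CONDITIONAL on its displayed
binders; nothing here is a BSD class theorem; no census label moves (T7); item 21420 is NOT closed; none of its registered
stubs is proved here. BSD is proved for no curve.

WHY. The registered line `Cruxes/CornerAtThreeW/Lines/inert.lean` (r21) carries the twist pair `stub_cornerTwistLower3 :
CornerAtThreeTwistLower` (the rank-`0` main-conjecture LOWER bound `Typed.MissingLowerBoundAt Wd 3` at EVERY odd Heegner twin —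
Skinner–Urban ∕ Skinner 2016 Thm. C grade, VOID in print on the rank-`0` corner: no (ram) prime, `p = 3`) and
`stub_cornerTwistMuAn3 : CornerAtThreeTwistMuAn`, and consumes them through `∀ W, Three.CornerTwistAt W` (full `BSD(E^{(d_K)},3)` at
every twin) in THREE places: (i) conjunct (W) `CornerTwistWitness.CornerTwistWitnessAt W` (ONE twin), (ii) lane B g4's converse bridge
(A) `Three.cornerUpperAt_of_missingUpperBoundAt_of_cornerTwistAt` for conjunct (U) at EVERY frame, (iii) the mono-carrier END on odd
`N` (`CornerTwinHalves.cornerTwinLowerModEightAt_of_cornerTwistAt`, ONE `d_K ≡ 1 (mod 8)` frame). The composition's own docstring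
announces «the benefit cut: replace the twist pair by ONE witness-shaped stub — a later reshape». THIS FILE supplies the (U)-side
half of its kernel; the (W)-side half is `…CornerAtThreeTwistWitnessOfTwinLowerModEight.lean` (file 2/2).

* §1 `twistKatoHalf_of_katoFacts_of_muAn` — the twin's KATO half `Typed.MissingUpperBoundAt Wd 3` at EVERY odd Heegner twin of a
  corner pair from the thirteen Kato-twin facts + the ANALYTIC `μ = 0` certificate at the twins: corner-p1 g6's chain
  `X11b.cornerTwistAt_of_lowerTwists_of_katoFacts_of_muAn` with its last step (the lower half) REMOVED. Class level:
  `twistKatoHalf3_of_katoFacts_of_muAn` from `KatoTwinFactsThreeAn`'s thirteen facts and `CornerAtThreeTwistMuAn`.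
* §2 (A′) `cornerUpperAt_of_missingUpperBoundAt_of_twistKatoHalf` — the SHARPENED converse bridge: `Three.CornerUpperAt W` at
  every odd-`d_K` Manin-good Heegner datum from the consumer shape `3 ∣ ∏c → Typed.MissingUpperBoundAt W 3` and the twin's KATO
  half ONLY (not `BSDp Wd 3`). The arithmetic is lane B g4's (A) with one `=` weakened to `≤`: multr1-p2's EXACT identity
  `v(q) + v(q_d) + v(∏c_W) + 2·v(t_d) = 2·v(I)`, `v(Ш_K) = v(Ш_W) + v(Ш_d)`; the consumer shape `v(Ш_W) ≤ v(q)`; the twin's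
  Kato half in print shape `v(Ш_d) + v(∏c_d) − 2·v(t_d) ≤ v(q_d)` (`X11b.exists_printShape_upper_of_missingUpperBoundAt_rankZero`);
  `v(∏c_d) = v(∏c_W)`; `omega`. So (U) at every frame costs the twin's `≤`-half, never its `≥`-half.
  Class level: `cornerAtThreeUpper_of_consumed_of_twistKatoHalf`; END `cornerAtThreeUpper_of_consumed_of_katoFacts_of_muAn`
  (`Theorems.CornerAtThreeUpper` ⟸ consumer shape + thirteen Kato facts + `CornerAtThreeTwistMuAn` + Gross–Zagier + Kolyvagin —
  `CornerAtThreeTwistLower` NOT a hypothesis).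

References: [JetchevSkinnerWan2017] §7.4.1 (eq:gz for K′), §7.4.2 (eq:shaupper), pp. 29–31 of arXiv:1512.06894; [Miller2011LMS]
Def. 1.1; [Kato2004Asterisque] Thm. 12.6, §17.13; [Wuthrich2014] Cor. 18; [SteinWuthrich2013] Thm. 6.1; tree: `…CornerAtThreeUpperConverse`
(lane B g4), `…CornerAtThreeBranches` (corner-p1 g6), `…ErratumRoadFiveNonSurjCornerLower` (corner-p1 g0).
-/

set_option autoImplicit false
set_option linter.dupNamespace false

noncomputable section

open scoped Classical NumberField MatrixGroups ModularForm

open CongruenceSubgroup WeierstrassCurve NumberField IsDedekindDomain Field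
  Literature.NumberTheory.EllipticCurves
  Literature.NumberTheory.EllipticCurves.ModularForms
  Literature.NumberTheory.EllipticCurves.Rank1Residual
  Literature.NumberTheory.EllipticCurves.Rank1Residual.Typed
  Literature.NumberTheory.EllipticCurves.Wuthrich2014
  Literature.NumberTheory.EllipticCurves.SteinWuthrich2013
  Literature.NumberTheory.EllipticCurves.Greenberg1999
  Literature.NumberTheory.EllipticCurves.Kato2004
  Literature.NumberTheory.QuadraticFields.Quadratic
  Literature.NumberTheory.Automorphic
  Summit.BirchSwinnertonDyer.Rank1Residual
  Summit.BirchSwinnertonDyer.Rank1Residual.X11b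
  Summit.BirchSwinnertonDyer.Rank1Residual.X11b.Three
  Summit.BirchSwinnertonDyer.BirchSwinnertonDyer.Theorems

namespace Summit.BirchSwinnertonDyer.BirchSwinnertonDyer.Theorems.TwistKatoHalf

/-! ### §1 The twin's KATO half at every odd Heegner twin, from the thirteen facts + the analytic certificate -/

/-- **The twin's KATO half `Typed.MissingUpperBoundAt Wd 3` at EVERY odd Heegner twin of a corner pair `(E,3)`** (`(E,3) ∈` X11b,
`ρ̄_{E,3}` not onto) from NAMED facts + the ANALYTIC `μ = 0` certificate at every such twin: Stein–Wuthrich Thm. 6.1 (`hJs`, `hJn`),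
GZK, modularity (`hmod`, `hpar`), Greenberg–Stevens, the six facts of the twin's rational Kato layer (`hne`, `h12`, `hns`, `hsp`,
`h15`, `h18`) and F1 at `p ∥ N` (`hfine`). At each twin `Wd = Cd • E^{(d_K)}`: multiplicative at `3`, `r_an = 0`, `E^{(d_K)}[3]`
irreducible, `ρ̄` not onto (twist lemmas), so `multDivisibilityAt_of_katoFacts_of_muAn` with the certificate read on `Wd` gives
`MultDivisibilityAt Wd 3`, then `missingUpperBoundAt_of_multDivisibilityAt_of_analyticRank_eq_zero`. EXACTLY corner-p1 g6's
`X11b.cornerTwistAt_of_lowerTwists_of_katoFacts_of_muAn` WITHOUT its `hlow` binder and last line. CONDITIONAL on `hAn` and the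
thirteen facts; nothing booked.
-- adapted from Summits/BirchSwinnertonDyer/BirchSwinnertonDyer/Theorems/ClassRecordThreeCornerAtThreeBranches.lean (§1)
[cite: Kato2004Asterisque, Thm. 12.6 (p. 222) and §17.13 (pp. 279–280)] [cite: Wuthrich2014, Cor. 18 (p. 398)]
[cite: SteinWuthrich2013, Thm. 6.1 (p. 20)] [cite: SilvermanAEC2009, X.5 Cor. 5.4] [cite: Miller2011LMS, §1 and Def. 1.1] -/
theorem twistKatoHalf_of_katoFacts_of_muAn
    (hJs : thm61_splitMultiplicative) (hJn : thm61_nonsplitMultiplicative)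
    (hGZK : rank_eq_analyticRank_of_analyticRank_le_one) (hmod : hasEntireLFunction_rat)
    (hpar : nonempty_modularParametrizationData)
    (hGS : ∀ (W : WeierstrassCurve ℚ) [W.IsElliptic] [W.IsGloballyMinimal] (p : ℕ) [Fact p.Prime],
      greenberg_stevens (W := W) (p := p))
    (hne : Kato2004.nonempty_iwasawaH1Data) (h12 : Kato2004.thm12_4)
    (hns : Kato2004.exists_multDivisibilityInputs_nonsplit)
    (hsp : Kato2004.exists_multDivisibilityInputs_split)
    (h15 : thm15_isTorsion_multiplicative_rat)
    (h18 : Wuthrich2014.corollary18_padicLFunction_mem_iwasawaAlgebra_multiplicative)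
    (hfine : Kato2004.exists_multDivisibilityInputs_fine)
    (W : WeierstrassCurve ℚ) [W.IsElliptic] [W.IsGloballyMinimal]
    (hAn : ∀ (K : Type) [Field K] [NumberField K]
      (Wd : WeierstrassCurve ℚ) [Wd.IsElliptic] [Wd.IsGloballyMinimal] (Cd : VariableChange ℚ),
      ClassX11b W 3 → ¬ Surj W 3 → IsImaginaryQuadratic K → Odd (NumberField.discr K) →
      SatisfiesHeegnerHypothesis (W.conductorNorm ℤ) K →
      (W.quadraticTwist (NumberField.discr K : ℚ)).entireLFunction 1 ≠ 0 →
      Cd • W.quadraticTwist (NumberField.discr K : ℚ) = Wd →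
      ∀ {N : ℕ} [NeZero N] (f : CuspForm (Gamma0 N) 2), IsNewformOf Wd f →
      ∀ (ϖ : ℚ), (ϖ : ℝ) * Wd.realPeriodRat = plusPeriod f →
      ∀ (a : ℚ_[3]) (L : PowerSeries ℚ_[3]),
        (Wd.HasSplitMultiplicativeReductionAtPrime 3 → a = 1) →
        (¬ Wd.HasSplitMultiplicativeReductionAtPrime 3 → a = -1) →
        IsMultPAdicLFunctionOf f 3 a L →
        ∃ n : ℕ, ‖PowerSeries.coeff n (PowerSeries.C ((ϖ : ℚ) : ℚ_[3]) * L)‖ = 1)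
    (K : Type) [Field K] [NumberField K]
    (Wd : WeierstrassCurve ℚ) [Wd.IsElliptic] [Wd.IsGloballyMinimal] (Cd : VariableChange ℚ)
    (hX : ClassX11b W 3) (hnsj : ¬ Surj W 3) (hKq : IsImaginaryQuadratic K) (hodd : Odd (NumberField.discr K))
    (hHN : SatisfiesHeegnerHypothesis (W.conductorNorm ℤ) K)
    (hLt : (W.quadraticTwist (NumberField.discr K : ℚ)).entireLFunction 1 ≠ 0)
    (hWd : Cd • W.quadraticTwist (NumberField.discr K : ℚ) = Wd) :
    Typed.MissingUpperBoundAt Wd 3 := by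
  have hD0 : (NumberField.discr K : ℚ) ≠ 0 := by exact_mod_cast NumberField.discr_ne_zero K
  have hmultd : Wd.HasMultiplicativeReductionAtPrime 3 :=
    hasMultiplicativeReductionAtPrime_twist_of_heegner' W 3 K hKq hHN hX.2.2.1 Cd hWd
  have hrd : Wd.analyticRank = 0 := analyticRank_heegnerTwist_eq_zero W K hLt Cd hWd
  have hirrd : Wd.HasIrreducibleModPGaloisRep 3 :=
    hasIrreducibleModPGaloisRep_twist_model W 3 K hKq.1 hX.2.2.2 Cd hWd
  have hnsd : ¬ Surj Wd 3 := not_surj_twist_model W 3 hD0 hnsj Cd hWd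
  have hdiv : MultDivisibilityAt Wd 3 :=
    multDivisibilityAt_of_katoFacts_of_muAn hne h12 hns hsp h15 h18 hfine Wd 3 (by decide) hmultd hirrd hnsd
      (fun f hf ϖ hϖ a L hsa hna hL ↦ hAn K Wd Cd hX hnsj hKq hodd hHN hLt hWd f hf ϖ hϖ a L hsa hna hL)
  exact missingUpperBoundAt_of_multDivisibilityAt_of_analyticRank_eq_zero hJs hJn hGZK hmod hpar Wd 3 (hGS Wd 3)
    (by decide) hmultd hrd hdiv

/-- **Class level: the twin's Kato half at every odd Heegner twin of EVERY corner curve** from the thirteen facts of birth's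
`KatoTwinFactsThreeAn` bundle (in the conjunct order of `cornerAtThree_of_branchesAn`'s `hF`) and the registered analytic child
`CornerAtThreeTwistMuAn` — in EXACTLY the binder shape `hTwU` of §3's class-level bridge. Bookkeeping over §2. CONDITIONAL; nothing booked.
[cite: Kato2004Asterisque, §17.13 (pp. 279–280)] [cite: Wuthrich2014, Cor. 18 (p. 398)] [cite: GreenbergLNM1716, §1 Conj. 1.11 (shape)] -/
theorem twistKatoHalf3_of_katoFacts_of_muAn
    (hF : thm61_splitMultiplicative ∧ thm61_nonsplitMultiplicative ∧
      rank_eq_analyticRank_of_analyticRank_le_one ∧ WeierstrassCurve.hasEntireLFunction_rat ∧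
      nonempty_modularParametrizationData ∧
      (∀ (W : WeierstrassCurve ℚ) [W.IsElliptic] [W.IsGloballyMinimal] (p : ℕ) [Fact p.Prime],
        greenberg_stevens (W := W) (p := p)) ∧
      Kato2004.nonempty_iwasawaH1Data ∧ Kato2004.thm12_4 ∧
      Kato2004.exists_multDivisibilityInputs_nonsplit ∧ Kato2004.exists_multDivisibilityInputs_split ∧
      thm15_isTorsion_multiplicative_rat ∧
      Wuthrich2014.corollary18_padicLFunction_mem_iwasawaAlgebra_multiplicative ∧
      Kato2004.exists_multDivisibilityInputs_fine)
    (hμ : CornerAtThreeTwistMuAn) :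
    ∀ (W : WeierstrassCurve ℚ) [W.IsElliptic] [W.IsGloballyMinimal] (K : Type) [Field K] [NumberField K]
      (Wd : WeierstrassCurve ℚ) [Wd.IsElliptic] [Wd.IsGloballyMinimal] (Cd : VariableChange ℚ),
      ClassX11b W 3 → ¬ Surj W 3 → IsImaginaryQuadratic K → Odd (NumberField.discr K) →
      SatisfiesHeegnerHypothesis (W.conductorNorm ℤ) K →
      (W.quadraticTwist (NumberField.discr K : ℚ)).entireLFunction 1 ≠ 0 →
      Cd • W.quadraticTwist (NumberField.discr K : ℚ) = Wd → Typed.MissingUpperBoundAt Wd 3 := by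
  obtain ⟨hJs, hJn, hGZK, hmod, hpar, hGS, hne, h12, hns, hsp, h15, h18, hfine⟩ := hF
  intro W _ _ K _ _ Wd _ _ Cd hX hnsj hKq hodd hHN hLt hWd
  exact twistKatoHalf_of_katoFacts_of_muAn hJs hJn hGZK hmod hpar hGS hne h12 hns hsp h15 h18 hfine W
    (fun K _ _ Wd _ _ Cd ↦ hμ W K Wd Cd) K Wd Cd hX hnsj hKq hodd hHN hLt hWd

/-! ### §2 (A′) The SHARPENED converse bridge: (U) at every frame from the consumer shape and the twin's Kato half -/

/-- **(A′) — `Three.CornerUpperAt W` from the consumer shape and the twin's KATO half only.** For `W/ℚ` globally minimal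
with `(E,3) ∈` X11b and `ρ̄_{E,3}` NOT surjective, granted the ℚ-level Euler-system half on `3 ∣ ∏_ℓ c_ℓ(E)`
(`hUB : 3 ∣ ∏c → Typed.MissingUpperBoundAt W 3`) and, at every odd Heegner twin `Wd = Cd • E^{(d_K)}`, the twin's `≤`-half
`Typed.MissingUpperBoundAt Wd 3` (`hTwU` — Kato's half; §2 supplies it from print + the analytic `μ = 0`), the Tamagawa-SHARP
bound `ord₃ #Ш(E/K) + 2·ord₃ ∏_ℓ c_ℓ(E) ≤ 2·ord₃ [E(K):ℤP]` holds at EVERY odd-`d_K` Heegner datum with `3 ∤ c(Dt)`. Proof =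
lane B g4's (A) with the twist's EXACT `3`-part replaced by its upper half: multr1-p2's identity
`v(q) + v(q_d) + v(∏c_W) + 2·v(t_d) = 2·v(I)` and `v(Ш_K) = v(Ш_W) + v(Ш_d)` (`X11b.exists_shaAn_padicVal_eq_of_heegner`) at the
datum, `v(Ш_W) ≤ v(q)` (`hUB`, uniqueness of the rational `#Ш_an`), `v(Ш_d) + v(∏c_d) − 2·v(t_d) ≤ v(q_d)` (`hTwU` put in print
shape by corner-p1 g0's `X11b.exists_printShape_upper_of_missingUpperBoundAt_rankZero`: `r_an(Wd) = 0`, `L(Wd,1) ≠ 0`, `Wd[3]`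
irreducible), the transports `v(∏c_d) = v(∏c_W)`, `v(u(Cd)) = 0`, the side conditions `3 ∤ d_K`, `3 ∤ #𝓞_K^×` from `3 ∣ N`, and
`omega`. The twin's `≥`-half is NOT used; nor is the typed conjunct's antecedent `¬ Surj W 3` (no binder `hns`: the arithmetic is image-free on
X11b). PUBLISHED binders `hGZ`, `hKo`, `hGZK`, `hmod`. CONDITIONAL on `hTwU`, `hUB`; nothing booked.
-- adapted from Summits/BirchSwinnertonDyer/BirchSwinnertonDyer/Theorems/ClassRecordThreeCornerAtThreeUpperConverse.lean (§1)
[cite: JetchevSkinnerWan2017, §7.4.1 (eq:gz for K′) and §7.4.2 (eq:shaupper), pp. 29–31] [cite: GrossLMS1991, §2 Conj. (2.2) (shape)]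
[cite: Miller2011LMS, Def. 1.1] -/
theorem cornerUpperAt_of_missingUpperBoundAt_of_twistKatoHalf [Fact (Nat.Prime 3)]
    (hGZ : ∀ (N : ℕ) [NeZero N] (W : WeierstrassCurve ℚ) (K : Type) [Field K] [NumberField K],
      gross_zagier N W K)
    (hKo : ∀ (N : ℕ) [NeZero N] (W : WeierstrassCurve ℚ) (K : Type) [Field K] [NumberField K],
      kolyvagin N W K)
    (hGZK : rank_eq_analyticRank_of_analyticRank_le_one) (hmod : hasEntireLFunction_rat)
    (W : WeierstrassCurve ℚ) [W.IsElliptic] [W.IsGloballyMinimal] (hX : ClassX11b W 3)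
    (hTwU : ∀ (K : Type) [Field K] [NumberField K]
      (Wd : WeierstrassCurve ℚ) [Wd.IsElliptic] [Wd.IsGloballyMinimal] (Cd : VariableChange ℚ),
      IsImaginaryQuadratic K → Odd (NumberField.discr K) →
      SatisfiesHeegnerHypothesis (W.conductorNorm ℤ) K →
      (W.quadraticTwist (NumberField.discr K : ℚ)).entireLFunction 1 ≠ 0 →
      Cd • W.quadraticTwist (NumberField.discr K : ℚ) = Wd → Typed.MissingUpperBoundAt Wd 3)
    (hUB : 3 ∣ W.tamagawaProduct → Typed.MissingUpperBoundAt W 3) :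
    Three.CornerUpperAt W := by
  intro N _ K _ _ Dt H ι P _ _ ht hN hK hodd hHN hLt hP hc _ _
  obtain ⟨hr, hp2, hmult, hirr⟩ := id hX
  -- the consumer shape: `ord₃ #Ш(E/ℚ) ≤ ord₃ q'` with `#Ш(E)_an = q'`
  obtain ⟨q', hq', hle⟩ := hUB ht
  -- `3 ∣ N`, so `3` splits in `K`: `3 ∤ d_K`, `3 ∤ #𝓞_K^×`
  have hpN : 3 ∣ W.conductorNorm ℤ :=
    (W.dvd_conductorNorm_iff_not_hasGoodReductionAtPrime 3).mpr
      (WeierstrassCurve.HasMultiplicativeReduction.not_hasGoodReduction (R := ℤ_[3]) hmult)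
  have hHNW : SatisfiesHeegnerHypothesis (W.conductorNorm ℤ) K := by rw [hN]; exact hHN
  obtain ⟨hpd, hμ⟩ := Three.not_dvd_discr_and_not_dvd_torsionOrder_of_heegner (p := 3) hK hHNW
    (by decide) hpN
  -- a globally minimal model of the twist by `d_K`, differing from the twisted equation by a `3`-unit
  have hD0 : (NumberField.discr K : ℚ) ≠ 0 := by exact_mod_cast NumberField.discr_ne_zero K
  haveI hEt : (W.quadraticTwist (NumberField.discr K : ℚ)).IsElliptic :=
    W.isElliptic_quadraticTwist hD0
  obtain ⟨Cd, hCd⟩ := hasGlobalMinimalModel_rat_holds (W.quadraticTwist (NumberField.discr K : ℚ))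
  haveI : (Cd • W.quadraticTwist (NumberField.discr K : ℚ)).IsGloballyMinimal := hCd
  set Wd : WeierstrassCurve ℚ := Cd • W.quadraticTwist (NumberField.discr K : ℚ) with hWd_def
  have hWd : Cd • W.quadraticTwist (NumberField.discr K : ℚ) = Wd := rfl
  have hu : padicValRat 3 (Cd.u : ℚ) = 0 :=
    padicValRat_u_eq_zero_of_twist_minimal W 3 K hK hHNW hmult Cd hWd
  have htam : padicValNat 3 Wd.tamagawaProduct = padicValNat 3 W.tamagawaProduct :=
    X2.padicValNat_tamagawaProduct_twist_of_heegner_of_odd W 3 hp2 K hK hodd hpd hHNW Cd hWd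
  -- the twin: analytic rank `0`, `L(Wd,1) ≠ 0`, `Wd[3]` irreducible
  have hLt' : (W.quadraticTwist (NumberField.discr K : ℚ)).entireLFunction = Wd.entireLFunction := by
    rw [← hWd, entireLFunction_smul]
  have hLd1 : Wd.entireLFunction 1 ≠ 0 := by rw [← hLt']; exact hLt
  have hrd : Wd.analyticRank = 0 := (Wd.analyticRank_eq_zero_iff_holds (hmod Wd)).2 hLd1
  have hirrd : Irr Wd 3 := hasIrreducibleModPGaloisRep_twist_model W 3 K hK.1 hirr Cd hWd
  -- the twin's KATO half, in print shape: `v(Ш_d) + v(∏c_d) − 2·v(t_d) ≤ v(q_d)`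
  obtain ⟨qd, hqd, hvqd⟩ := exists_printShape_upper_of_missingUpperBoundAt_rankZero Wd 3 hGZK hrd hLd1 hirrd
    (hTwU K Wd Cd hK hodd hHNW hLt hWd)
  -- the exact Gross–Zagier bookkeeping identity at THIS datum
  obtain ⟨-, -, hsha, q, hq, hval⟩ := exists_shaAn_padicVal_eq_of_heegner W 3 N K Dt H ι P
    (hGZ N W K) (hKo N W K) hGZK hmod hK hHN hP hp2 hc hμ hr hLt Wd Cd hWd hu qd hqd
  -- the rational `#Ш_an` is unique
  have hqq : q' = q := by exact_mod_cast hq'.symm.trans hq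
  subst hqq
  have e2 : (padicValNat 3 (W.baseChange K).shaOrder : ℤ) =
      padicValNat 3 W.shaOrder + padicValNat 3 Wd.shaOrder := by exact_mod_cast hsha
  have e3 : (padicValNat 3 Wd.tamagawaProduct : ℤ) = padicValNat 3 W.tamagawaProduct := by
    exact_mod_cast htam
  have e4 : (padicValNat 3 (W.baseChange K).shaOrder : ℤ) + 2 * padicValNat 3 W.tamagawaProduct ≤
      2 * padicValNat 3 (AddSubgroup.zmultiples P).index := by omega
  exact_mod_cast e4

/-- **Class level (A′): `Theorems.CornerAtThreeUpper` (= `∀ W, Three.CornerUpperAt W`) from its CONSUMER shape at every corner curve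
and the twin's KATO half at every odd Heegner twin of every corner curve** (binder `hTwU`, the conclusion shape of
`twistKatoHalf3_of_katoFacts_of_muAn`), plus the named print {Gross–Zagier, Kolyvagin, GZK, modularity}. Off the corner the
typed conjunct is vacuous. Bookkeeping over `cornerUpperAt_of_missingUpperBoundAt_of_twistKatoHalf`. CONDITIONAL; closes nothing.
[cite: JetchevSkinnerWan2017, §7.4.2 (eq:shaupper), p. 31] [cite: Miller2011LMS, Def. 1.1] -/
theorem cornerAtThreeUpper_of_consumed_of_twistKatoHalf [Fact (Nat.Prime 3)]
    (hGZ : ∀ (N : ℕ) [NeZero N] (W : WeierstrassCurve ℚ) (K : Type) [Field K] [NumberField K],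
      gross_zagier N W K)
    (hKo : ∀ (N : ℕ) [NeZero N] (W : WeierstrassCurve ℚ) (K : Type) [Field K] [NumberField K],
      kolyvagin N W K)
    (hGZK : rank_eq_analyticRank_of_analyticRank_le_one) (hmod : hasEntireLFunction_rat)
    (hTwU : ∀ (W : WeierstrassCurve ℚ) [W.IsElliptic] [W.IsGloballyMinimal] (K : Type) [Field K] [NumberField K]
      (Wd : WeierstrassCurve ℚ) [Wd.IsElliptic] [Wd.IsGloballyMinimal] (Cd : VariableChange ℚ),
      ClassX11b W 3 → ¬ Surj W 3 → IsImaginaryQuadratic K → Odd (NumberField.discr K) →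
      SatisfiesHeegnerHypothesis (W.conductorNorm ℤ) K →
      (W.quadraticTwist (NumberField.discr K : ℚ)).entireLFunction 1 ≠ 0 →
      Cd • W.quadraticTwist (NumberField.discr K : ℚ) = Wd → Typed.MissingUpperBoundAt Wd 3)
    (hU : ∀ (W : WeierstrassCurve ℚ) [W.IsElliptic] [W.IsGloballyMinimal],
      ClassX11b W 3 → ¬ Surj W 3 → 3 ∣ W.tamagawaProduct → Typed.MissingUpperBoundAt W 3) :
    CornerAtThreeUpper := by
  intro W _ _
  by_cases hX : ClassX11b W 3
  · by_cases hns : ¬ Surj W 3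
    · exact cornerUpperAt_of_missingUpperBoundAt_of_twistKatoHalf hGZ hKo hGZK hmod W hX
        (fun K _ _ Wd _ _ Cd hK hodd hHN hLt hWd ↦ hTwU W K Wd Cd hX hns hK hodd hHN hLt hWd) (hU W hX hns)
    · intro N _ K _ _ Dt H ι P _ hns' _ _ _ _ _ _ _ _ _ _
      exact absurd hns' hns
  · intro N _ K _ _ Dt H ι P hX' _ _ _ _ _ _ _ _ _ _ _
    exact absurd hX' hX

/-- **Class level, END of conjunct (U) WITHOUT the twin's `≥`-half: `Theorems.CornerAtThreeUpper` ⟸ {its consumer shape at every corner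
curve, the thirteen Kato-twin facts, the analytic child `CornerAtThreeTwistMuAn`, Gross–Zagier, Kolyvagin}.** (GZK and modularity are
conjuncts 3–4 of the bundle.) The registered `stub_cornerTwistLower3 : CornerAtThreeTwistLower` is NOT among the hypotheses. Bookkeeping:
`cornerAtThreeUpper_of_consumed_of_twistKatoHalf` ∘ `twistKatoHalf3_of_katoFacts_of_muAn`. CONDITIONAL; closes nothing.
[cite: JetchevSkinnerWan2017, §7.4.2 (eq:shaupper), p. 31] [cite: Kato2004Asterisque, §17.13 (pp. 279–280)] [cite: Wuthrich2014, Cor. 18 (p. 398)] -/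
theorem cornerAtThreeUpper_of_consumed_of_katoFacts_of_muAn [Fact (Nat.Prime 3)]
    (hGZ : ∀ (N : ℕ) [NeZero N] (W : WeierstrassCurve ℚ) (K : Type) [Field K] [NumberField K],
      gross_zagier N W K)
    (hKo : ∀ (N : ℕ) [NeZero N] (W : WeierstrassCurve ℚ) (K : Type) [Field K] [NumberField K],
      kolyvagin N W K)
    (hF : thm61_splitMultiplicative ∧ thm61_nonsplitMultiplicative ∧
      rank_eq_analyticRank_of_analyticRank_le_one ∧ WeierstrassCurve.hasEntireLFunction_rat ∧
      nonempty_modularParametrizationData ∧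
      (∀ (W : WeierstrassCurve ℚ) [W.IsElliptic] [W.IsGloballyMinimal] (p : ℕ) [Fact p.Prime],
        greenberg_stevens (W := W) (p := p)) ∧
      Kato2004.nonempty_iwasawaH1Data ∧ Kato2004.thm12_4 ∧
      Kato2004.exists_multDivisibilityInputs_nonsplit ∧ Kato2004.exists_multDivisibilityInputs_split ∧
      thm15_isTorsion_multiplicative_rat ∧
      Wuthrich2014.corollary18_padicLFunction_mem_iwasawaAlgebra_multiplicative ∧
      Kato2004.exists_multDivisibilityInputs_fine)
    (hμ : CornerAtThreeTwistMuAn)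
    (hU : ∀ (W : WeierstrassCurve ℚ) [W.IsElliptic] [W.IsGloballyMinimal],
      ClassX11b W 3 → ¬ Surj W 3 → 3 ∣ W.tamagawaProduct → Typed.MissingUpperBoundAt W 3) :
    CornerAtThreeUpper :=
  cornerAtThreeUpper_of_consumed_of_twistKatoHalf hGZ hKo hF.2.2.1 hF.2.2.2.1 (twistKatoHalf3_of_katoFacts_of_muAn hF hμ) hU

end Summit.BirchSwinnertonDyer.BirchSwinnertonDyer.Theorems.TwistKatoHalf

end
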